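import Summits.KontsevichZagierPeriods.KontsevichZagierPeriods.Theorems.GammaHodgeSector.Negative.LoadBearing
import Literature.NumberTheory.Transcendental.KZProductIdeal
import Literature.NumberTheory.Transcendental.KZKernelConjectureForms
import Literature.NumberTheory.Transcendental.KontsevichZagierGammaProofs
import Literature.NumberTheory.Transcendental.LindemannWeierstrassProofs

/-!
# Sketch — crux-ideate stmt-KontsevichZagierPeriods-10378 (`GammaSectorComplete`, "GSC"),
ideator 3, round 1 (planner-cruxidea-stmt-KontsevichZagierPeriods-10378-3-0, 2026-08-16)

Scratch file for the three idea cards.  RETARGETED 03:3xZ: both routes dropped the decl `GammaSectorComplete`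
(stmt-10378) at 03:09Z for the equivalent subgroup form `CompleteModGammaSector` (stmt-14233); this file now
proves `CompleteModGammaSector ↔ GammaSectorComplete ↔ KernelModG`, so every statement below is a statement
about the live crux as well.  Everything here elaborates; the theorems are proved
(no `sorry`); the `def … : Prop` items are the TYPED FIRST LEMMAS / claims of the cards.

* §0  `G`, the kernel form `KernelModG`, and `GammaSectorComplete ↔ KernelModG` (PROVED).
* §A  card `fermat-torus-lattice-ideal`: the level-`L` Fermat sector, `FermatSectorKernelModG L`,
      the Lang–Rohrlich conjecture in transcendence-degree form `LangRohrlichTrdeg L`, and the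
      PROVED instances `langRohrlichTrdeg_three/_four/_six/_two/_one` (Chudnovsky, Lindemann —
      tree theorems).
* §B  card `chowla-selberg-interface`: the typed interface pair `ChowlaSelbergSeven`
      (real period of `49a1` against `B(1/7,2/7)`), and its `… ModG` form.
* §C  card `spectator-stability-split`: `IdealKernelModG`, `SpectatorStability`, and
      `KernelModG ↔ IdealKernelModG ∧ SpectatorStability` (PROVED); `ConstantStability` (typed, open);
      the ENGINE `of_cube_sub_of_scaledCube_mem` (a pure cube and a scaled cube of one Koblitz–Ogus
      class differ by one generator + one reindexing move — PROVED) and `constantStability_realisable`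
      (PROVED); cube spectators typed.
* §B′ `CMSevenSectorClaim` (typed; uses `ConstantStability`).

Relation to `Cruxes/GammaSectorComplete/Disproof.lean` (cdisprove, published 02:54Z, read at the filing
boundary): its §2 `gammaSectorComplete_iff_ker_le` is the same kernel form as `gammaSectorComplete_iff_kernelModG`
below (derived independently; `G` here = `closure gammaHodgePairs` there, `relations ⊔ G` = `sector`).
-/

noncomputable section

open MeasureTheory Set
open scoped BigOperators Cardinal

namespace Summit.KontsevichZagierPeriods.KontsevichZagierPeriods.Cruxes.GammaSectorComplete.Ideator3

set_option linter.dupNamespace false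

open Literature.NumberTheory.Transcendental
open Literature.NumberTheory.Transcendental.KZ
open Summit.KontsevichZagierPeriods.KontsevichZagierPeriods.Theses.TerasomaMultiplication (CompleteModGammaSector GammaHodgeSector)
open Summit.KontsevichZagierPeriods.GammaHodgeSectorNegative (Admissible CoprimeDen hodgeSum HodgeCondition IsCubeBetaRep IsBallCubeRep)

/-! ## §0 The Γ-Hodge subgroup `G` and the kernel form of the crux -/

/-- The generating set of the Γ-Hodge sector subgroup, VERBATIM the set inside the crux
`GammaSectorComplete` (so that `gammaSectorComplete_iff` below is `Iff.rfl`). -/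
def gammaPairs : Set FormalRep :=
  {d : FormalRep | ∃ (N N' k : ℕ) (x y : Fin N → ℚ) (x' y' : Fin N' → ℚ) (c : ℝ) (ρ : IntegralRep N) (ρ' : IntegralRep (2 * k + N')), (∀ j, 0 < x j ∧ 0 < y j ∧ Int.fract (x j) ≠ 0 ∧ Int.fract (y j) ≠ 0) ∧ (∀ l, 0 < x' l ∧ 0 < y' l ∧ Int.fract (x' l) ≠ 0 ∧ Int.fract (y' l) ≠ 0) ∧ (∀ u : ℕ, 0 < u → (∀ j, Nat.Coprime u (x j).den ∧ Nat.Coprime u (y j).den) → (∀ l, Nat.Coprime u (x' l).den ∧ Nat.Coprime u (y' l).den) → ((∑ j, (Int.fract ((u : ℚ) * x j) + Int.fract ((u : ℚ) * y j) - Int.fract ((u : ℚ) * (x j + y j)))) - ∑ l, (Int.fract ((u : ℚ) * x' l) + Int.fract ((u : ℚ) * y' l) - Int.fract ((u : ℚ) * (x' l + y' l)))) = (k : ℚ)) ∧ IsAlgebraic ℚ c ∧ ρ.domain = {t | ∀ j, t j ∈ Set.Ioo (0:ℝ) 1} ∧ Set.EqOn ρ.integrand (fun t => ∏ j, (t j)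 ^ ((x j : ℝ) - 1) * (1 - t j) ^ ((y j : ℝ) - 1)) ρ.domain ∧ ρ'.domain = {z | (∑ i : Fin (2 * k), (z (Fin.castAdd N' i)) ^ 2) < 1 ∧ ∀ l : Fin N', z (Fin.natAdd (2 * k) l) ∈ Set.Ioo (0:ℝ) 1} ∧ Set.EqOn ρ'.integrand (fun z => c * (k.factorial : ℝ) * ∏ l, (z (Fin.natAdd (2 * k) l)) ^ ((x' l : ℝ) - 1) * (1 - z (Fin.natAdd (2 * k) l)) ^ ((y' l : ℝ) - 1)) ρ'.domain ∧ ρ.value = ρ'.value ∧ d = of ρ - of ρ'}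

/-- The Γ-Hodge sector subgroup `G = closure(gammaPairs)`. -/
def G : AddSubgroup FormalRep := AddSubgroup.closure gammaPairs

/-- KERNEL FORM of the crux modulo `G`: `ker eval ≤ relations ⊔ G`. -/
def KernelModG : Prop := ∀ c : FormalRep, eval c = 0 → c ∈ relations ⊔ G

/-- `GammaSectorComplete` — VERBATIM the statement of the shared item stmt-KontsevichZagierPeriods-10378
(the sup/closure form; it was a `def` of both route files MotivatedMoves / TerasomaMultiplication until
2026-08-16T03:09Z, when both routes replaced it by the EQUIVALENT subgroup form `CompleteModGammaSector`,
stmt-14233 — see `completeModGammaSector_iff_gammaSectorComplete` below).  Kept here as a local `def` so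
that this file elaborates against the current tree and everything proved transfers to the new decl. -/
def GammaSectorComplete : Prop :=
  ∀ ⦃n m : ℕ⦄ (r : IntegralRep n) (r' : IntegralRep m),
    r.IsRational → r'.IsRational → r.value = r'.value → of r - of r' ∈ relations ⊔ G

/-- The crux, unfolded against `G` (definitional). -/
theorem gammaSectorComplete_iff :
    GammaSectorComplete ↔ ∀ ⦃n m : ℕ⦄ (r : IntegralRep n) (r' : IntegralRep m),
      r.IsRational → r'.IsRational → r.value = r'.value → of r - of r' ∈ relations ⊔ G :=
  Iff.rfl

/-- **The NEW crux decl is the old one**: `CompleteModGammaSector` (stmt-14233, subgroup form, the route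
decl since 03:09Z) ↔ `GammaSectorComplete` (stmt-10378, sup/closure form).  PROVED. -/
theorem completeModGammaSector_iff_gammaSectorComplete :
    CompleteModGammaSector ↔ GammaSectorComplete := by
  constructor
  · intro h n m r r' hr hr' hv
    refine h (relations ⊔ G) le_sup_left ?_ r r' hr hr' hv
    intro N N' k x y x' y' c hx hx' hu hc ρ ρ' hd hi hd' hi' hval
    exact le_sup_right (α := AddSubgroup FormalRep)
      (AddSubgroup.subset_closure ⟨N, N', k, x, y, x', y', c, ρ, ρ', hx, hx', hu, hc, hd, hi, hd', hi', hval, rfl⟩)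
  · intro h H hrel hpairs n m r r' hr hr' hv
    have hle : relations ⊔ G ≤ H := by
      refine sup_le hrel ((AddSubgroup.closure_le _).mpr ?_)
      rintro d ⟨N, N', k, x, y, x', y', c, ρ, ρ', hx, hx', hu, hc, hd, hi, hd', hi', hval, rfl⟩
      exact hpairs N N' k x y x' y' c hx hx' hu hc ρ ρ' hd hi hd' hi' hval
    exact hle (h r r' hr hr' hv)

/-- Generators of `G` evaluate to `0` (their two sides have equal values by definition). -/
theorem eval_eq_zero_of_mem_gammaPairs {d : FormalRep} (hd : d ∈ gammaPairs) : eval d = 0 := by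
  obtain ⟨N, N', k, x, y, x', y', c, ρ, ρ', -, -, -, -, -, -, -, -, hv, rfl⟩ := hd
  rw [eval_of_sub_of, hv, sub_self]

/-- `G ≤ ker eval`. -/
theorem G_le_ker : G ≤ (eval : FormalRep →+ ℝ).ker :=
  (AddSubgroup.closure_le _).mpr fun _ hd => (AddMonoidHom.mem_ker).mpr (eval_eq_zero_of_mem_gammaPairs hd)

/-- `relations ⊔ G ≤ ker eval` (soundness of the enlarged calculus). -/
theorem sup_le_ker : relations ⊔ G ≤ (eval : FormalRep →+ ℝ).ker :=
  sup_le relations_le_ker_eval_holds G_le_ker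

/-- **GSC ⇒ kernel form.** Bookkeeping exactly as in `KZKernelConjecture.of_kzPeriodConjecture'`
plus `exists_isRational_equivalent` to reach rational endpoints. -/
theorem kernelModG_of_gammaSectorComplete (h : GammaSectorComplete) : KernelModG := by
  intro c hc
  obtain ⟨n, m, r, r', hrel⟩ := exists_integralRep_sub_holds c
  obtain ⟨N, R, hR, hrR⟩ := exists_isRational_equivalent_holds r
  obtain ⟨N', R', hR', hrR'⟩ := exists_isRational_equivalent_holds r'
  have hker : eval (c - (of r - of r')) = 0 := relations_le_ker_eval_holds hrel
  rw [map_sub, hc, zero_sub, neg_eq_zero, eval_of_sub_of, sub_eq_zero] at hker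
  have hvR : R.value = R'.value := by
    rw [← Equivalent.value_eq_holds hrR, ← Equivalent.value_eq_holds hrR', hker]
  have hRR' : of R - of R' ∈ relations ⊔ G := h R R' hR hR' hvR
  have h1 : of r - of R ∈ relations ⊔ G := le_sup_left (α := AddSubgroup FormalRep) hrR
  have h2 : of R' - of r' ∈ relations ⊔ G := le_sup_left (α := AddSubgroup FormalRep) hrR'.symm
  have h3 : of r - of r' ∈ relations ⊔ G := by
    have := add_mem (add_mem h1 hRR') h2
    convert this using 1
    abel
  have h4 : c - (of r - of r') ∈ relations ⊔ G := le_sup_left (α := AddSubgroup FormalRep) hrel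
  have := add_mem h4 h3
  simpa using this

/-- **Kernel form ⇒ GSC.** -/
theorem gammaSectorComplete_of_kernelModG (h : KernelModG) : GammaSectorComplete := by
  intro n m r r' _ _ hv
  exact h _ (by rw [eval_of_sub_of, hv, sub_self])

/-- **The crux is its kernel form modulo `G`.** -/
theorem gammaSectorComplete_iff_kernelModG : GammaSectorComplete ↔ KernelModG :=
  ⟨kernelModG_of_gammaSectorComplete, gammaSectorComplete_of_kernelModG⟩

/-- The live crux decl in kernel form. -/
theorem completeModGammaSector_iff_kernelModG : CompleteModGammaSector ↔ KernelModG :=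
  completeModGammaSector_iff_gammaSectorComplete.trans gammaSectorComplete_iff_kernelModG

/-- Sanity: the summit implies the kernel form modulo `G` (hence the crux). -/
theorem kernelModG_of_summit (h : _root_.KontsevichZagierPeriods) : KernelModG := fun c hc =>
  le_sup_left (α := AddSubgroup FormalRep) ((kzKernelConjecture_iff_isRational.mpr h) c hc)

/-! ## §A Card `fermat-torus-lattice-ideal` -/

/-- Exponent data of level `L`: every denominator divides `L`. -/
def HasLevel {N : ℕ} (L : ℕ) (x y : Fin N → ℚ) : Prop := ∀ j, (x j).den ∣ L ∧ (y j).den ∣ L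

/-- The PURE CUBE representations of level `L`: `[(0,1)^N, Π t_j^{x_j−1}(1−t_j)^{y_j−1}]` with
admissible (positive, non-integer) exponents of level `L` — no constant, no ball. -/
def cubeReps (L : ℕ) : Set FormalRep :=
  {d | ∃ (N : ℕ) (x y : Fin N → ℚ) (ρ : IntegralRep N),
    Admissible x y ∧ HasLevel L x y ∧ IsCubeBetaRep x y ρ ∧ d = of ρ}

/-- The level-`L` FERMAT SECTOR: the `ℤ`-span of the pure cube representations of level `L`
(closed under the Fubini product up to reindexing; values = `ℚ`-combinations of products of
`B(a,b)`, `a,b ∈ L⁻¹ℤ`). -/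
def fermatSector (L : ℕ) : AddSubgroup FormalRep := AddSubgroup.closure (cubeReps L)

/-- FIRST LEMMA of card A (typed): the kernel form of the crux ON THE LEVEL-`L` FERMAT SECTOR.
Claimed: provable now for `L ∈ {1,2,3,4,6}` (Chudnovsky/Lindemann + lattice-ideal theorem +
Deligne constants + integrand additivity); implied by `LangRohrlichTrdeg L` for every `L`. -/
def FermatSectorKernelModG (L : ℕ) : Prop :=
  ∀ c ∈ fermatSector L, eval c = 0 → c ∈ relations ⊔ G

/-- The kernel form trivially specialises to the sector. -/
theorem fermatSectorKernelModG_of_kernelModG (h : KernelModG) (L : ℕ) : FermatSectorKernelModG L :=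
  fun c _ hc => h c hc

/-- `π` and the values `Γ(i/L)`, `0 < i < L`. -/
def gammaValues (L : ℕ) : Set ℝ :=
  insert Real.pi ((fun i : ℕ => Real.Gamma ((i : ℝ) / (L : ℝ))) '' Set.Ico 1 L)

/-- OPEN CONJECTURE (Lang–Rohrlich, transcendence-degree form, level `L`): `tr.deg_ℚ ℚ(π, Γ(1/L),
…, Γ((L−1)/L)) ≥ 1 + φ(L)/2` (the upper bound `≤` is Deligne/Koblitz–Ogus + the standard
relations). THEOREM for `L ∣ 4`, `L ∣ 6` (Chudnovsky 1976; Lindemann), see below. -/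
def LangRohrlichTrdeg (L : ℕ) : Prop :=
  ((1 + Nat.totient L / 2 : ℕ) : Cardinal) ≤ Algebra.trdeg ℚ ↥(IntermediateField.adjoin ℚ (gammaValues L))

/-- CLAIM of card A (typed, to be proved by the line): Lang–Rohrlich at level `L` closes the
level-`L` Fermat sector of the crux modulo `G`. -/
def FermatSectorClaim (L : ℕ) : Prop := LangRohrlichTrdeg L → FermatSectorKernelModG L

theorem pi_mem_gammaValues (L : ℕ) : Real.pi ∈ gammaValues L := Set.mem_insert _ _

theorem gamma_mem_gammaValues {L i : ℕ} (h1 : 1 ≤ i) (h2 : i < L) :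
    Real.Gamma ((i : ℝ) / (L : ℝ)) ∈ gammaValues L :=
  Set.mem_insert_of_mem _ ⟨i, ⟨h1, h2⟩, rfl⟩

/-- Two algebraically independent members of `S` give `tr.deg ℚ(S) ≥ 2`. [folklore] -/
theorem two_le_trdeg_adjoin {S : Set ℝ} {a b : ℝ} (ha : a ∈ S) (hb : b ∈ S)
    (h : AlgebraicIndependent ℚ ![a, b]) :
    (2 : Cardinal) ≤ Algebra.trdeg ℚ ↥(IntermediateField.adjoin ℚ S) := by
  set L := IntermediateField.adjoin ℚ S
  have hmem : ∀ i : Fin 2, (![a, b] i) ∈ L := by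
    intro i
    fin_cases i
    · exact IntermediateField.subset_adjoin ℚ S ha
    · exact IntermediateField.subset_adjoin ℚ S hb
  have h' : AlgebraicIndependent ℚ fun i : Fin 2 => (⟨![a, b] i, hmem i⟩ : L) :=
    AlgebraicIndependent.of_comp L.val h
  simpa using h'.cardinalMk_le_trdeg

/-- One transcendental member of `S` gives `tr.deg ℚ(S) ≥ 1`. [folklore] -/
theorem one_le_trdeg_adjoin {S : Set ℝ} {a : ℝ} (ha : a ∈ S) (h : Transcendental ℚ a) :
    (1 : Cardinal) ≤ Algebra.trdeg ℚ ↥(IntermediateField.adjoin ℚ S) := by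
  set L := IntermediateField.adjoin ℚ S
  have hmem : ∀ i : Fin 1, (![a] i) ∈ L := by
    intro i
    fin_cases i
    exact IntermediateField.subset_adjoin ℚ S ha
  have h0 : AlgebraicIndependent ℚ ![a] := algebraicIndependent_unique_type_iff.mpr h
  have h' : AlgebraicIndependent ℚ fun i : Fin 1 => (⟨![a] i, hmem i⟩ : L) :=
    AlgebraicIndependent.of_comp L.val h0
  simpa using h'.cardinalMk_le_trdeg

/-- **Lang–Rohrlich at level 4 is Chudnovsky's theorem** (`π`, `Γ(1/4)` algebraically
independent; tree theorem `algebraicIndependent_real_pi_gamma_one_quarter`). -/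
theorem langRohrlichTrdeg_four : LangRohrlichTrdeg 4 := by
  unfold LangRohrlichTrdeg
  have ht : Nat.totient 4 = 2 := by decide
  rw [ht]
  norm_num
  have hΓ : Real.Gamma ((1 : ℕ) / ((4 : ℕ) : ℝ)) ∈ gammaValues 4 := gamma_mem_gammaValues le_rfl (by norm_num)
  have hΓ' : Real.Gamma (1 / 4) ∈ gammaValues 4 := by simpa using hΓ
  exact two_le_trdeg_adjoin (pi_mem_gammaValues 4) hΓ' algebraicIndependent_real_pi_gamma_one_quarter

/-- **Lang–Rohrlich at level 3 is Chudnovsky's theorem** (`π`, `Γ(1/3)`). -/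
theorem langRohrlichTrdeg_three : LangRohrlichTrdeg 3 := by
  unfold LangRohrlichTrdeg
  have ht : Nat.totient 3 = 2 := by decide
  rw [ht]
  norm_num
  have hΓ : Real.Gamma ((1 : ℕ) / ((3 : ℕ) : ℝ)) ∈ gammaValues 3 := gamma_mem_gammaValues le_rfl (by norm_num)
  have hΓ' : Real.Gamma (1 / 3) ∈ gammaValues 3 := by simpa using hΓ
  exact two_le_trdeg_adjoin (pi_mem_gammaValues 3) hΓ' algebraicIndependent_real_pi_gamma_one_third

/-- **Lang–Rohrlich at level 6** (`Γ(2/6) = Γ(1/3)`). -/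
theorem langRohrlichTrdeg_six : LangRohrlichTrdeg 6 := by
  unfold LangRohrlichTrdeg
  have ht : Nat.totient 6 = 2 := by decide
  rw [ht]
  norm_num
  have hΓ : Real.Gamma ((2 : ℕ) / ((6 : ℕ) : ℝ)) ∈ gammaValues 6 := gamma_mem_gammaValues (by norm_num) (by norm_num)
  have h13 : ((2 : ℕ) : ℝ) / ((6 : ℕ) : ℝ) = 1 / 3 := by norm_num
  rw [h13] at hΓ
  exact two_le_trdeg_adjoin (pi_mem_gammaValues 6) hΓ algebraicIndependent_real_pi_gamma_one_third

/-- **Lang–Rohrlich at level 2 is Lindemann's theorem** (`π` transcendental; tree theorem). -/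
theorem langRohrlichTrdeg_two : LangRohrlichTrdeg 2 := by
  unfold LangRohrlichTrdeg
  have ht : Nat.totient 2 = 1 := by decide
  rw [ht]
  norm_num
  exact one_le_trdeg_adjoin (pi_mem_gammaValues 2) transcendental_pi_holds

/-- Level 1 (Lindemann). -/
theorem langRohrlichTrdeg_one : LangRohrlichTrdeg 1 := by
  unfold LangRohrlichTrdeg
  have ht : Nat.totient 1 = 1 := by decide
  rw [ht]
  norm_num
  exact one_le_trdeg_adjoin (pi_mem_gammaValues 1) transcendental_pi_holds

/-! ## §B Card `chowla-selberg-interface` -/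

/-- The real-period domain of the CM curve `49a1` (`y² + xy = x³ − x² − 2x − 1`, CM by
`ℤ[(1+√−7)/2]`): with `η = 2y + x`, `η² = 4x³ − 3x² − 8x − 4 = (x − 2)(4x² + 5x + 2)`, and
`Ω = ∫_{E(ℝ)} |dx/η| = 2∫_2^∞ dx/√((x−2)(4x²+5x+2))` is the AREA of this unbounded
`ℚ`-semialgebraic set (integrand `1`). Numerically `Ω = 1.9333117056…`. -/
def omega49Domain : Set (Fin 2 → ℝ) :=
  {z | 2 < z 0 ∧ (z 1) ^ 2 * ((z 0 - 2) * (4 * (z 0) ^ 2 + 5 * z 0 + 2)) < 1}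

/-- The Chowla–Selberg(−7) constant: `Ω(49a1) = B(1/7,2/7) / (2√7·sin(3π/7))`, i.e.
`Ω = Γ(1/7)Γ(2/7)Γ(4/7)/(2π√7)` rewritten with `Γ(3/7)Γ(4/7) = π/sin(3π/7)`
(checked numerically to `1e-16` by the ideator; real algebraic). -/
def cs7Const : ℝ := 1 / (2 * Real.sqrt 7 * Real.sin (3 * Real.pi / 7))

/-- FIRST LEMMA of card B (typed): the CHOWLA–SELBERG(−7) INTERFACE PAIR — the real period of
`49a1` against the level-7 beta cube `cs7Const · B(1/7,2/7)`, as a KZ-equivalence. Expected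
chain: Klein quartic `v⁷ = u(1−u)²` (Jacobian `~ E³`) → `E = X₀(49)` is a Galois `C₃`-quotient
(degree 3): sheets (rule 2 on injectivity cells) + exact algebraic forms (rule 3) + additivity;
no Γ, no transcendence (value equality is a hypothesis, house style of `GammaHodgeSector`). -/
def ChowlaSelbergSeven : Prop :=
  ∀ (r : IntegralRep 2) (ρ : IntegralRep 1),
    r.domain = omega49Domain → EqOn r.integrand (fun _ => 1) r.domain →
    ρ.domain = {t | t 0 ∈ Ioo (0:ℝ) 1} →
    EqOn ρ.integrand (fun t => cs7Const * (t 0) ^ ((1 / 7 : ℝ) - 1) * (1 - t 0) ^ ((2 / 7 : ℝ) - 1)) ρ.domain →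
    r.value = ρ.value → Equivalent r ρ

/-- What the crux actually needs from the interface pair: membership modulo `G`. -/
def ChowlaSelbergSevenModG : Prop :=
  ∀ (r : IntegralRep 2) (ρ : IntegralRep 1),
    r.domain = omega49Domain → EqOn r.integrand (fun _ => 1) r.domain →
    ρ.domain = {t | t 0 ∈ Ioo (0:ℝ) 1} →
    EqOn ρ.integrand (fun t => cs7Const * (t 0) ^ ((1 / 7 : ℝ) - 1) * (1 - t 0) ^ ((2 / 7 : ℝ) - 1)) ρ.domain →
    r.value = ρ.value → of r - of ρ ∈ relations ⊔ G

theorem chowlaSelbergSevenModG_of (h : ChowlaSelbergSeven) : ChowlaSelbergSevenModG :=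
  fun r ρ h1 h2 h3 h4 h5 => le_sup_left (α := AddSubgroup FormalRep) (h r ρ h1 h2 h3 h4 h5)

theorem chowlaSelbergSevenModG_of_kernelModG (h : KernelModG) : ChowlaSelbergSevenModG :=
  fun r ρ _ _ _ _ hv => h _ (by rw [eval_of_sub_of, hv, sub_self])

/-- The PRODUCT FORM of the interface identity with a RATIONAL constant (what the `G`-collapse uses,
no algebraic constant to move): `16·π⁴·Ω(49a1) = B(1/7,2/7)·B(1/7,6/7)·B(2/7,5/7)·B(3/7,4/7)²`
(checked numerically to `3e-16`): `[disc⁴ × Ω-area, 16]` (dimension 10, rational) against the pure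
level-7 five-cube. -/
def cs7ProductDomain : Set (Fin 10 → ℝ) :=
  {z | z 0 ^ 2 + z 1 ^ 2 < 1 ∧ z 2 ^ 2 + z 3 ^ 2 < 1 ∧ z 4 ^ 2 + z 5 ^ 2 < 1 ∧ z 6 ^ 2 + z 7 ^ 2 < 1 ∧
    2 < z 8 ∧ (z 9) ^ 2 * ((z 8 - 2) * (4 * (z 8) ^ 2 + 5 * z 8 + 2)) < 1}

/-- Exponent data of the five-cube `β(1/7,2/7)β(1/7,6/7)β(2/7,5/7)β(3/7,4/7)β(3/7,4/7)`. -/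
def cs7x : Fin 5 → ℚ := ![1/7, 1/7, 2/7, 3/7, 3/7]
/-- (second exponents) -/
def cs7y : Fin 5 → ℚ := ![2/7, 6/7, 5/7, 4/7, 4/7]

/-- CS(−7), product form with rational constant: a pair of RATIONAL/pure-cube representations. -/
def ChowlaSelbergSevenProduct : Prop :=
  ∀ (r : IntegralRep 10) (ρ : IntegralRep 5),
    r.domain = cs7ProductDomain → EqOn r.integrand (fun _ => 16) r.domain →
    IsCubeBetaRep cs7x cs7y ρ → r.value = ρ.value → Equivalent r ρ

/-- The `ℚ(√−7)`-ISOTYPIC CM SECTOR of level 7: `ℤ`-span of the area representation of `Ω(49a1)`,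
the disc `[π]`, the level-7 pure cubes, and their Fubini products (typed as the closure of the
generators under `*`; products of generators are again generators of this shape up to reindexing,
which is a relation). -/
def cmSevenGenerators : Set FormalRep :=
  {d | ∃ r : IntegralRep 2, r.domain = omega49Domain ∧ EqOn r.integrand (fun _ => 1) r.domain ∧ d = of r}
    ∪ {of piRep} ∪ cubeReps 7

/-- Monomials: finite (left-nested or not) Fubini products of generators. -/
inductive IsCMSevenMonomial : FormalRep → Prop
  | gen {d : FormalRep} (hd : d ∈ cmSevenGenerators) : IsCMSevenMonomial d
  | mul {d e : FormalRep} (hd : IsCMSevenMonomial d) (he : IsCMSevenMonomial e) : IsCMSevenMonomial (d * e)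

/-- The multiplicative-additive span of the generators (all finite products, all `ℤ`-combinations). -/
def cmSevenSector : AddSubgroup FormalRep := AddSubgroup.closure {d | IsCMSevenMonomial d}

/-! ## §C Card `spectator-stability-split` -/

/-- Spectator multiples of the generators: `[s] * d`, `s` ANY representation, `d ∈ gammaPairs`. -/
def spectatorPairs : Set FormalRep :=
  {x | ∃ (l : ℕ) (s : IntegralRep l) (d : FormalRep), d ∈ gammaPairs ∧ x = of s * d}

/-- The (left-)ideal-style enlargement of `G`: closure of generators and their spectator multiples. -/
def Gideal : AddSubgroup FormalRep := AddSubgroup.closure (gammaPairs ∪ spectatorPairs)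

/-- IDEAL KERNEL FORM modulo `G`: `ker eval ≤ relations ⊔ Gideal` — the form a Tannakian /
dimension-count argument naturally proves. Weaker than `KernelModG` a priori. -/
def IdealKernelModG : Prop := ∀ c : FormalRep, eval c = 0 → c ∈ relations ⊔ Gideal

/-- SPECTATOR STABILITY: the Γ-Hodge sector is an ideal modulo moves — every spectator multiple of
a Deligne pair lies in `relations ⊔ G`. Transcendence-free; implied by the crux; the seam between
the subgroup form (as typed in the route) and the ideal form. -/
def SpectatorStability : Prop :=
  ∀ (l : ℕ) (s : IntegralRep l) (d : FormalRep), d ∈ gammaPairs → of s * d ∈ relations ⊔ G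

/-- FIRST LEMMA of card C (typed, claimed provable now by `Fin.append` bookkeeping + one
reindexing move): spectator stability for PURE-CUBE spectators — appending the same admissible
cube factor to both sides of a Deligne pair gives a Deligne pair (Hodge sums add, values scale). -/
def SpectatorStabilityCubes : Prop :=
  ∀ (M : ℕ) (a b : Fin M → ℚ) (s : IntegralRep M), Admissible a b → IsCubeBetaRep a b s →
    ∀ d ∈ gammaPairs, of s * d ∈ relations ⊔ G

/-- CONSTANT STABILITY — the first open instance of spectator stability: scaling a Deligne pair by a
real algebraic constant (a 0-dimensional spectator `[pt, λ]`) stays in `relations ⊔ G`. Needed by every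
sector whose interface identities carry irrational algebraic constants (card B); implied by the crux. -/
def ConstantStability : Prop :=
  ∀ (lam : ℝ), IsAlgebraic ℚ lam → ∀ (s : IntegralRep 0), s.domain = Set.univ → EqOn s.integrand (fun _ => lam) s.domain →
    ∀ d ∈ gammaPairs, of s * d ∈ relations ⊔ G

/-- Value of a representation whose integrand is a constant multiple of another's on a common domain. -/
theorem value_of_eqOn_const_mul {N : ℕ} (ρ σ : IntegralRep N) (lam : ℝ) (hd : σ.domain = ρ.domain)
    (hi : EqOn σ.integrand (fun t => lam * ρ.integrand t) σ.domain) : σ.value = lam * ρ.value := by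
  unfold IntegralRep.value
  rw [setIntegral_congr_fun (IntegralRep.measurableSet_domain_holds σ) hi, hd, integral_const_mul]

/-- Reindexing does not change the value (it is a move, and moves are sound). -/
theorem value_reindex {N K : ℕ} (σ : IntegralRep N) (e : Fin N ≃ Fin K) :
    (σ.reindex e).value = σ.value := by
  have h : eval (of σ - of (σ.reindex e)) = 0 :=
    relations_le_ker_eval_holds (of_sub_of_reindex_mem_relations σ e)
  rw [eval_of_sub_of, sub_eq_zero] at h
  exact h.symm

/-- **A pure cube and a SCALED cube of the same Koblitz–Ogus class differ by one generator of `G`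
(k = 0) plus one reindexing move** — the engine of the fibre collapse (card A) and of realisable
constant stability (card C).  PROVED. -/
theorem of_cube_sub_of_scaledCube_mem {M N : ℕ} (a b : Fin M → ℚ) (x y : Fin N → ℚ) (c' : ℝ)
    (ρ₃ : IntegralRep M) (τ : IntegralRep N)
    (ha : Admissible a b) (hx : Admissible x y) (h3 : IsCubeBetaRep a b ρ₃)
    (hτd : τ.domain = {t | ∀ l, t l ∈ Ioo (0:ℝ) 1})
    (hτi : EqOn τ.integrand (fun t => c' * ∏ l, (t l) ^ ((x l : ℝ) - 1) * (1 - t l) ^ ((y l : ℝ) - 1)) τ.domain)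
    (hH : ∀ u : ℕ, 0 < u → CoprimeDen a b u → CoprimeDen x y u → hodgeSum a b u - hodgeSum x y u = 0)
    (hc' : IsAlgebraic ℚ c') (hv : ρ₃.value = τ.value) :
    of ρ₃ - of τ ∈ relations ⊔ G := by
  set e : Fin N ≃ Fin (2 * 0 + N) := finCongr (by omega) with he
  have hecoe : ∀ l : Fin N, e l = Fin.natAdd (2 * 0) l := by
    intro l; ext; simp [he]
  have hrel : of τ - of (τ.reindex e) ∈ relations := of_sub_of_reindex_mem_relations τ e
  have hG : of ρ₃ - of (τ.reindex e) ∈ G := by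
    apply AddSubgroup.subset_closure
    refine ⟨M, N, 0, a, b, x, y, c', ρ₃, τ.reindex e, ha, hx, ?_, hc', h3.1, h3.2, ?_, ?_, ?_, rfl⟩
    · intro u hu h1 h2
      have := hH u hu h1 h2
      simpa [hodgeSum] using this
    · ext z
      simp only [IntegralRep.reindex_domain, hτd, Set.mem_setOf_eq]
      constructor
      · intro hz
        refine ⟨?_, fun l => ?_⟩
        · have hemp : (Finset.univ : Finset (Fin (2 * 0))) = ∅ := by
            haveI : IsEmpty (Fin (2 * 0)) := ⟨fun i => absurd i.2 (by omega)⟩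
            exact Finset.univ_eq_empty
          rw [hemp, Finset.sum_empty]
          exact one_pos
        · rw [← hecoe]; exact hz l
      · rintro ⟨-, hz⟩ l
        rw [hecoe]; exact hz l
    · intro z hz
      simp only [IntegralRep.reindex_integrand, IntegralRep.reindex_domain, Set.mem_setOf_eq] at hz ⊢
      rw [hτi hz]
      simp only [hecoe, Nat.factorial_zero, Nat.cast_one, mul_one]
    · rw [hv, value_reindex]
  have hmem := sub_mem (le_sup_right (a := relations) hG) (le_sup_left (b := G) hrel)
  convert hmem using 1
  abel

/-- REALISABLE CONSTANT STABILITY (PROVED): if `λ·value(ρ)` is the value of some admissible pure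
cube `ρ₃` of the same Koblitz–Ogus class, then scaling the (k = 0) Deligne pair `(ρ, c·cube')` by `λ`
stays in `relations ⊔ G`: both scaled sides are right-hand sides of generators with left side `ρ₃`.
(The three class hypotheses are stated with their own coprimality guards, as the crux does.) -/
theorem constantStability_realisable {N N' M : ℕ} (x y : Fin N → ℚ) (x' y' : Fin N' → ℚ)
    (a b : Fin M → ℚ) (c lam : ℝ)
    (ρ : IntegralRep N) (ρ' : IntegralRep N') (ρ₃ : IntegralRep M) (σ : IntegralRep N) (σ' : IntegralRep N')
    (hx : Admissible x y) (hx' : Admissible x' y') (ha : Admissible a b)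
    (hρ : IsCubeBetaRep x y ρ) (h3 : IsCubeBetaRep a b ρ₃)
    (hρ'd : ρ'.domain = {t | ∀ l, t l ∈ Ioo (0:ℝ) 1})
    (hρ'i : EqOn ρ'.integrand (fun t => c * ∏ l, (t l) ^ ((x' l : ℝ) - 1) * (1 - t l) ^ ((y' l : ℝ) - 1)) ρ'.domain)
    (hH₃ : ∀ u : ℕ, 0 < u → CoprimeDen a b u → CoprimeDen x y u → hodgeSum a b u - hodgeSum x y u = 0)
    (hH₃' : ∀ u : ℕ, 0 < u → CoprimeDen a b u → CoprimeDen x' y' u → hodgeSum a b u - hodgeSum x' y' u = 0)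
    (hc : IsAlgebraic ℚ c) (hlam : IsAlgebraic ℚ lam) (hv : ρ.value = ρ'.value)
    (h3v : ρ₃.value = lam * ρ.value)
    (hσd : σ.domain = ρ.domain) (hσi : EqOn σ.integrand (fun t => lam * ρ.integrand t) σ.domain)
    (hσ'd : σ'.domain = ρ'.domain) (hσ'i : EqOn σ'.integrand (fun t => lam * ρ'.integrand t) σ'.domain) :
    of σ - of σ' ∈ relations ⊔ G := by
  -- σ is the scaled cube `lam × cube(x,y)`, σ' is `(lam*c) × cube(x',y')`
  have hσi' : EqOn σ.integrand (fun t => lam * ∏ l, (t l) ^ ((x l : ℝ) - 1) * (1 - t l) ^ ((y l : ℝ) - 1)) σ.domain := by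
    intro t ht
    have ht' : t ∈ ρ.domain := by rw [← hσd]; exact ht
    simp only [hσi ht]
    rw [hρ.2 ht']
  have hσ'i' : EqOn σ'.integrand (fun t => (lam * c) * ∏ l, (t l) ^ ((x' l : ℝ) - 1) * (1 - t l) ^ ((y' l : ℝ) - 1)) σ'.domain := by
    intro t ht
    have ht' : t ∈ ρ'.domain := by rw [← hσ'd]; exact ht
    simp only [hσ'i ht]
    rw [hρ'i ht', mul_assoc]
  have hvσ : σ.value = lam * ρ.value := value_of_eqOn_const_mul ρ σ lam hσd hσi
  have hvσ' : σ'.value = lam * ρ'.value := value_of_eqOn_const_mul ρ' σ' lam hσ'd hσ'i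
  have h1 : of ρ₃ - of σ ∈ relations ⊔ G :=
    of_cube_sub_of_scaledCube_mem a b x y lam ρ₃ σ ha hx h3 (hσd.trans hρ.1) hσi' hH₃ hlam
      (by rw [h3v, hvσ])
  have h2 : of ρ₃ - of σ' ∈ relations ⊔ G :=
    of_cube_sub_of_scaledCube_mem a b x' y' (lam * c) ρ₃ σ' ha hx' h3 (hσ'd.trans hρ'd) hσ'i' hH₃'
      (hlam.mul hc) (by rw [h3v, hvσ', hv])
  have hmem := sub_mem h2 h1
  convert hmem using 1
  abel

theorem eval_spectator_eq_zero {l : ℕ} (s : IntegralRep l) {d : FormalRep} (hd : d ∈ gammaPairs) :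
    eval (of s * d) = 0 := by
  rw [eval_mul', eval_eq_zero_of_mem_gammaPairs hd, mul_zero]

/-- **The split (PROVED): `KernelModG ↔ IdealKernelModG ∧ SpectatorStability`.** -/
theorem kernelModG_iff_ideal_and_spectator :
    KernelModG ↔ IdealKernelModG ∧ SpectatorStability := by
  constructor
  · intro h
    refine ⟨fun c hc => ?_, fun l s d hd => h _ (eval_spectator_eq_zero s hd)⟩
    have hle : relations ⊔ G ≤ relations ⊔ Gideal :=
      sup_le_sup_left (AddSubgroup.closure_mono subset_union_left) _
    exact hle (h c hc)
  · rintro ⟨hI, hS⟩ c hc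
    have hGi : Gideal ≤ relations ⊔ G := by
      refine (AddSubgroup.closure_le _).mpr ?_
      rintro x (hx | ⟨l, s, d, hd, rfl⟩)
      · exact le_sup_right (α := AddSubgroup FormalRep) (AddSubgroup.subset_closure hx)
      · exact hS l s d hd
    have hle : relations ⊔ Gideal ≤ relations ⊔ G := sup_le le_sup_left hGi
    exact hle (hI c hc)

/-- Hence the crux itself splits. -/
theorem gammaSectorComplete_iff_ideal_and_spectator :
    GammaSectorComplete ↔ IdealKernelModG ∧ SpectatorStability :=
  gammaSectorComplete_iff_kernelModG.trans kernelModG_iff_ideal_and_spectator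

/-- In particular the crux forces spectator stability (a transcendence-free necessary condition). -/
theorem spectatorStability_of_gammaSectorComplete (h : GammaSectorComplete) : SpectatorStability :=
  (gammaSectorComplete_iff_ideal_and_spectator.mp h).2

/-- …and cube-spectator stability is a special case. -/
theorem spectatorStabilityCubes_of (h : SpectatorStability) : SpectatorStabilityCubes :=
  fun M _ _ s _ _ d hd => h M s d hd

/-! ## §B′ (placed after §C because it uses `ConstantStability`) -/

/-- SECOND STUB of card B (typed): kernel form on the level-7 CM sector modulo `G`.  Claimed
derivable from: the interface identity in PRODUCT form as a relation (`ChowlaSelbergSevenProduct`,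
rational constant), KZ's arcsine chain `[disc] ~ [β(½,½)]` (support), Chudnovsky for `49a1`
(`chudnovsky_holds` + the CM relation on quasi-periods ⇒ `π`, `Ω` algebraically independent: the
`ℚ(√−7)`-ISOTYPIC classes need nothing more), `LangRohrlichTrdeg 7` for the non-isotypic classes (open),
the lattice-ideal collapse of card A, and — because members with fewer than four disc factors per
`Ω` factor must be multiplied up before the product identity applies — EITHER `ConstantStability`
(card C) for the level-7 Deligne-type constants OR `π`-cancellation modulo `G`.  The statement records
the `ConstantStability` variant. -/
def CMSevenSectorClaim : Prop :=
  ChowlaSelbergSevenProduct → ConstantStability → LangRohrlichTrdeg 7 →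
    ∀ c ∈ cmSevenSector, eval c = 0 → c ∈ relations ⊔ G

end Summit.KontsevichZagierPeriods.KontsevichZagierPeriods.Cruxes.GammaSectorComplete.Ideator3
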